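import Mathlib
import Literature.NumberTheory.LFunctions.Zhang2022.TypedSection16B
import HarnessLib

/-!
# Zhang (2022) §16 (16.16) in the TWO-PIECE transmitted reading `Eq16_16R2` — the RT-03 node of record
# (ZHANG-L discharge lane, zl-lead RULING R-17; rows G-L4t5-1, G-L4t5-2, G-d57-1) — typed statement + lift

Topic `Literature/NumberTheory/LFunctions/Zhang2022` (Landau–Siegel audit tree; verdict-neutral).
Y. Zhang, *Discrete mean estimates and the Landau–Siegel zero*, arXiv:2211.02515v1 (2022)
[Zhang2022LandauSiegel] — **an unrefereed manuscript under adjudication. The `def … : Prop` below is a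
READING of the manuscript's display (16.16), STATED NOT ASSERTED; it is NOT PRINTED in this form.**
Nothing in this file asserts or denies Theorems 1–2 of the source or says anything about Landau–Siegel
zeros; typed ≠ discharged ≠ true-in-print.

WHY THIS NODE EXISTS (numbers, not adjectives). The printed (16.16) (§16 p. 95, tex L4671),
`𝒮₂ⱼ = 𝔞𝔢ⱼ(φ(D)/D)L′(1,χ) + O(1/𝓛⁴)`, is the typed CLAIM `Typed.Section16B.Eq16_16` (uniform error
`C·(ell D ^ 4)⁻¹`); the cell's GAP rows G-L4t5-1 / G-L4t5-2 / G-d57-1 record that the printed route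
(16.13)–(16.15) + Lemma 16.2 does not transmit that rate: (16.15) carries `O(1/𝓛)` (tex L4636), and the
contour-shift step u041 carries the factor `(1 + |L′(1,χ)|)³` on its `𝓛⁻⁴` in the derivable (repaired)
reading `Step16_u041aR`/`Step16_u041bR`. The tree's repaired chain end `Typed.Section16B.Eq16_16R`
MAX-MERGES the two error pieces into `C(1+|L′(1,χ)|)³𝓛⁻¹` (`step16_u042R_of_repair`), which the relative
§16 endgame (`Skeleton.Eval1617Rel`, error `ε(𝔞+1)𝔓`) absorbs only with a Mertens-grade input
`∏_{q∣D}(q+1)/(q−1) = o(𝓛)`; kept in TWO PIECES, `C·(𝓛⁻¹ + (1+|L′(1,χ)|)³𝓛⁻⁴)` — exactly what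
`step16_u042R_of_repair` proves before its `max` — the endgame closes on tree facts (Lemma 5.7
`Section16Endgame.self_div_totient_le_norm_deriv_L_one`, `Lemma31.norm_deriv_LFunction_le_near_one`,
`∏_{q∣D}(1+1/q) ≤ 1 + log D`), see wp16/WP16-PLAN.md §1.3 (iv). Ruling R-17 (2026-08-26T22:21:42Z)
re-types the skeleton binder `h16_16 : Eq16_16 c′` ONE-FOR-ONE to `Eq16_16R2 c′` (RETYPE-LEDGER RT-03),
with preconditions `eval1617Rel_of_R2 : Prop141 → Step16_u010 c′ → Eq16_12 c′ → Eq16_16R2 c′ →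
Eval1617Rel c′` and `eq16_16R2_of_subleaves : Eq16_15 → Inline16_nsetRemovable → Step16_u040a →
Step16_u040b → Step16_u041aR → Lemma162R → Eq16_16R2` (owner zl-w16-p4; separate proof files).

What is here: the node decl `Eq16_16R2` (text = zl-w16-plan's `Sketch.lean` draft, verbatim) and the
kernel lift `eq16_16R_of_eq16_16R2 : Eq16_16R2 c′ → Eq16_16R c′` (the max-merge: the new node is at least
as strong as the old chain end). No instance, no notation, no other declaration; 0 facts.

## References

* Y. Zhang, arXiv:2211.02515v1 (2022), §16 (16.13)–(16.16) pp. 93–95 (tex L4593–L4673), (16.15)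
  tex L4636, §2 (2.31). [cite: Zhang2022LandauSiegel, §16 (16.16) p.95]
-/

noncomputable section

open Complex Real
open Literature.NumberTheory.LFunctions.Zhang2022
open Literature.NumberTheory.LFunctions.Zhang2022.Skeleton
open Literature.NumberTheory.LFunctions.Zhang2022.Typed.Section16A

namespace Literature.NumberTheory.LFunctions.Zhang2022.Typed.Section16B

variable (c' : ℝ)

/-- **(16.16) with the error that (16.15) and the repaired Lemma 16.2 chain transmit, kept in TWO
PIECES** (RT-03 node of record, zl-lead R-17): `𝒮₂ⱼ = 𝔞𝔢ⱼ(φ(D)/D)L′(1,χ) + O(𝓛⁻¹ + (1+|L′(1,χ)|)³𝓛⁻⁴)`,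
`j = 1, 2` — i.e. `Typed.Section16B.Eq16_16R` verbatim except that the right-hand side is not max-merged
(`𝒮₂ⱼ = Section16A.calS2`, `𝔞 = Skeleton.frakA`, `𝔢ⱼ = frake j`). NOT PRINTED (the printed (16.16),
§16 p. 95 tex L4671, claims `O(1/𝓛⁴)` = `Eq16_16`); GAP rows G-L4t5-1, G-L4t5-2, G-d57-1; implies
`Eq16_16R` (`eq16_16R_of_eq16_16R2`). CLAIM (reading), stated not asserted.
[cite: Zhang2022LandauSiegel, §16 (16.16) p.95] -/
def Eq16_16R2 : Prop :=
  ∃ C : ℝ, ForAllLarge fun D _ χ => AssumptionA D χ → ∀ j ∈ ({1, 2} : Finset ℕ),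
    ‖calS2 c' χ j - (frakA χ : ℂ) * frake j * ((Nat.totient D : ℂ) / (D : ℂ)) * deriv χ.LFunction 1‖ ≤
      C * ((ell D)⁻¹ + (1 + ‖deriv χ.LFunction 1‖) ^ 3 * (ell D ^ 4)⁻¹)

/-- `⌈e^L⌉ ≤ D ⇒ L ≤ 𝓛`. [folklore] -/
private theorem le_ell_of_ceil_exp_le_R2 {L : ℝ} {D : ℕ} (hD : ⌈Real.exp L⌉₊ ≤ D) : L ≤ ell D := by
  have h : Real.exp L ≤ D := le_trans (Nat.le_ceil _) (by exact_mod_cast hD)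
  exact (Real.le_log_iff_exp_le (lt_of_lt_of_le (Real.exp_pos _) h)).mpr h

/-- The max-merge `C(𝓛⁻¹ + (1+x)³𝓛⁻⁴) ≤ 2·max(C,0)·(1+x)³·𝓛⁻¹` for `𝓛 ≥ 1`, `x ≥ 0`. [folklore] -/
private theorem two_piece_le_merged {C L x : ℝ} (hL : 1 ≤ L) (hx : 0 ≤ x) :
    C * (L⁻¹ + (1 + x) ^ 3 * (L ^ 4)⁻¹) ≤ 2 * max C 0 * (1 + x) ^ 3 * L⁻¹ := by
  have hL0 : 0 < L := by linarith
  have hcube : 1 ≤ (1 + x) ^ 3 := one_le_pow₀ (le_add_of_nonneg_right hx)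
  have hinv : (L ^ 4)⁻¹ ≤ L⁻¹ := by
    refine inv_anti₀ hL0 ?_
    calc L = L ^ 1 := (pow_one _).symm
      _ ≤ L ^ 4 := pow_le_pow_right₀ hL (by norm_num)
  have hLi : 0 ≤ L⁻¹ := inv_nonneg.mpr hL0.le
  have hsum : L⁻¹ + (1 + x) ^ 3 * (L ^ 4)⁻¹ ≤ 2 * (1 + x) ^ 3 * L⁻¹ := by
    have h1 : L⁻¹ ≤ (1 + x) ^ 3 * L⁻¹ := by
      calc L⁻¹ = 1 * L⁻¹ := (one_mul _).symm
        _ ≤ (1 + x) ^ 3 * L⁻¹ := mul_le_mul_of_nonneg_right hcube hLi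
    have h2 : (1 + x) ^ 3 * (L ^ 4)⁻¹ ≤ (1 + x) ^ 3 * L⁻¹ :=
      mul_le_mul_of_nonneg_left hinv (le_trans zero_le_one hcube)
    linarith
  have hnn : 0 ≤ L⁻¹ + (1 + x) ^ 3 * (L ^ 4)⁻¹ :=
    add_nonneg hLi (mul_nonneg (le_trans zero_le_one hcube) (inv_nonneg.mpr (pow_nonneg hL0.le 4)))
  calc C * (L⁻¹ + (1 + x) ^ 3 * (L ^ 4)⁻¹) ≤ max C 0 * (L⁻¹ + (1 + x) ^ 3 * (L ^ 4)⁻¹) :=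
        mul_le_mul_of_nonneg_right (le_max_left _ _) hnn
    _ ≤ max C 0 * (2 * (1 + x) ^ 3 * L⁻¹) := mul_le_mul_of_nonneg_left hsum (le_max_right _ _)
    _ = 2 * max C 0 * (1 + x) ^ 3 * L⁻¹ := by ring

/-- **The two-piece node implies the tree's max-merged chain end**: `Eq16_16R2 c′ → Eq16_16R c′`
(`𝓛⁻⁴ ≤ 𝓛⁻¹` and `1 ≤ (1+|L′|)³` once `𝓛 ≥ 1`). [cite: Zhang2022LandauSiegel, §16 (16.16) p.95] -/
theorem eq16_16R_of_eq16_16R2 (h : Eq16_16R2 c') : Eq16_16R c' := by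
  obtain ⟨C, D₀, hC⟩ := h
  refine ⟨2 * max C 0, max D₀ ⌈Real.exp 1⌉₊, fun D _ χ hD hq hp hA j hj => ?_⟩
  have e := hC D χ (le_trans (le_max_left _ _) hD) hq hp hA j hj
  exact le_trans e (two_piece_le_merged
    (le_ell_of_ceil_exp_le_R2 (le_trans (le_max_right _ _) hD)) (norm_nonneg _))

end Literature.NumberTheory.LFunctions.Zhang2022.Typed.Section16B
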